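import Summits.QuantumFields.BalabanUV.T4Continuum.Support.SmallFieldDomainsPeriodic
import Literature.MathematicalPhysics.QuantumFieldTheory.Balaban1983to89.B5Ineq137Torus

/-!
# T⁴ programme, SUBSTRATE — `Support/SmallFieldDomainsObserved`: the READING MAP «per-level torus plaquette sets ↦ periodic bad fine-point
# sets `bad : ℕ → Set (Pt d)`» that the domain-tower constructor `domainTower` consumes (junction S-GEOM × S-LF; XREAD leaf-01-g12 INFO-2,
# typer MAP v0.5 §4 p4 (3) ∕ O-6‴)

Audit cell `pub-balaban`, SUBSTRATE cell seat p4; companion of `Support/SmallFieldDomainsTower` (`domainTower L M₁ R Ω₀ bad`) and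
`Support/SmallFieldDomainsPeriodic` (`SetPeriodic`, `domainTower_periodic`, `cubeIdx_add_single_mul`), same namespace; the V1 torus vocabulary
`Params`, `Site P j = Fin d → ZMod (P.sitesPerDir j)`, `Site.shift`, `Plaq P j` of `Literature/…/Balaban1983to89/Setup` and the torus block map
`B5Ineq137Torus.blk` ∕ `pow_mul_sitesPerDir` (`L^j·N_j = N₀`) of `Literature/…/B5Ineq137Torus` BY NAME (nothing restated).

THE GAP THIS FILE CLOSES (XREAD leaf-01-g12 INFO-2, journal l.14290): the S-LF side produces, per level `j`, FINITE SETS OF LEVEL-`j` TORUS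
PLAQUETTES (`SubstrateLargeField….observed … : List (Finset (Plaq P j))`, row NE7b's histories), while the S-GEOM constructor `domainTower` wants
`bad : ℕ → Set (Pt d)` — PERIODIC sets of FINE points on the cover `ℤ^d` of the finest torus `T^{(0)}`.  `SmallFieldDomainsPeriodic` typed the torus
half (`torIndex`, periodicity of the tower GIVEN periodic `bad`); the map between the two was in no module.
THE READING (declared; the cell's, not a printed formula): a fine point `x ∈ ℤ^d` (cover of `T^{(0)}`, `N₀ = P.sitesPerDir 0 = 2L^{m+K}` sites per
direction) has the LEVEL-`j` SITE `siteOfPt P j x := (⌊x/L^j⌋ mod N_j) ∈ Site P j` (`N_j = P.sitesPerDir j`; B12's centred block map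
`Setup.blockOf` iterated `j` times is integer division by `L^j` on representatives), and `x` is BAD AT LEVEL `j` for a plaquette set `Z_j` iff
that site is one of the four corner sites of a plaquette of `Z_j` (`plaqSites`).  Beyond the standing range `j ≤ m + K` nothing is bad.
WHAT THIS FILE PROVIDES (all `[folklore]`):
 * §1 `siteOfPt` — constant on `L^j`-blocks (`siteOfPt_eq_of_cubeIdx_eq`), equal to the torus block map `B5Ineq137Torus.blk` on canonical lifts
   (`siteOfPt_liftTor`), and `N₀`-PERIODIC for `j ≤ m + K` (`siteOfPt_add_single_period`, from `L^j · N_j = N₀`);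
 * §2 `plaqSites`, **`badOfPlaqs P j Z`** with `mem_badOfPlaqs_iff`, `∅ ↦ ∅`, monotone, `∪`-additive, a UNION OF `L^j`-BLOCKS
   (`badOfPlaqs_isUnionOfCubes`) and `N₀`-PERIODIC (`badOfPlaqs_periodic`);
 * §3 **`badOfObserved P Z : ℕ → Set (Pt d)`** for a per-level family `Z : (j : ℕ) → Finset (Plaq P j)` (empty above `m + K`), periodic at
   EVERY level (`badOfObserved_periodic`), hence **`domainTower_badOfObserved_periodic`**: the domain tower built on a periodic `Ω₀` and these bad
   sets is periodic at every level `j ≤ k` (`domainTower_periodic` BY NAME, under its divisibility hypothesis `M₁L^j ∣ N₀`, `j ≤ k`).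
 * §4 (v1.1, append-only; XREAD leaf-05-g17 INFO-2) the STAGE ↦ LEVEL junction with `SubstrateLargeFieldNestedSharp.observed` (a stage list at one
   level): `stagesUnion` (+ `mem_stagesUnion_iff`, `subset_stagesUnion`), **`badOfHistories P H := badOfObserved P (fun j => stagesUnion (H j))`**, `mem_badOfHistories_iff`,
   `badOfPlaqs_subset_badOfHistories`, `domainTower_badOfHistories_periodic`.
HONEST FRAMING (T4-DAG p. 1).  Set bookkeeping `ℤ^d ↔ ℤ/N`; no configuration, no estimate; which plaquettes are bad is INPUT (row NE7b ∕ S-LF), not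
decided here.  NOT an estimate of any NE row; spine 0/9 unchanged; NOT infinite volume, NOT a mass gap, NOT Clay.  HONEST DEPENDENCY: continuum YM
on T⁴ ⇐ BetaPertH ∧ nine spine estimates (0/9 proved); BetaPertH ⇐ (D1) ∧ (D4) ∧ CAP+tail; G-an2-4 gates asym, D1 and NE2/3/4.  No `sorry`.
-/

noncomputable section

namespace Summit.QuantumFields.BalabanUV.T4Continuum.SmallFieldDomains

open Literature.MathematicalPhysics.QuantumFieldTheory.Balaban1983to89.B14DomainGeom
open Literature.MathematicalPhysics.QuantumFieldTheory.Balaban1983to89 (Params Site Plaq)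
open Literature.MathematicalPhysics.QuantumFieldTheory.Balaban1983to89.B5Ineq137Torus (blk pow_mul_sitesPerDir)

variable (P : Params)

/-! ## §1 The level-`j` torus site of a fine point -/

/-- The period of the finest torus `T^{(0)}` in every direction: `N₀ = P.sitesPerDir 0`. [folklore] -/
def finePeriod : Fin P.d → ℕ := fun _ => P.sitesPerDir 0

/-- THE LEVEL-`j` SITE OF A FINE POINT of the cover `ℤ^d` of `T^{(0)}`: the level-`j` torus site of its `L^j`-block, `⌊x/L^j⌋ mod N_j`.
[folklore] -/
def siteOfPt (j : ℕ) (x : Pt P.d) : Site P j := fun μ => ((cubeIdx (P.L ^ j) x μ : ℤ) : ZMod (P.sitesPerDir j))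

/-- The level-`j` site depends on `x` only through its `L^j`-block. [folklore] -/
theorem siteOfPt_eq_of_cubeIdx_eq {j : ℕ} {x y : Pt P.d} (h : cubeIdx (P.L ^ j) x = cubeIdx (P.L ^ j) y) :
    siteOfPt P j x = siteOfPt P j y := by
  funext μ
  simp only [siteOfPt, h]

/-- JUNCTION WITH THE TORUS BLOCK MAP: on the canonical lift of a site of the finest torus, `siteOfPt` IS `B5Ineq137Torus.blk` (integer division of
the representatives by `L^j`). [folklore] -/
theorem siteOfPt_liftTor (j : ℕ) (p : Fin P.d → ZMod (P.sitesPerDir 0)) : siteOfPt P j (liftTor p) = blk P j p := by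
  funext μ
  have h1 : cubeIdx (P.L ^ j) (liftTor p) μ = (((p μ).val / P.L ^ j : ℕ) : ℤ) := by
    simp only [cubeIdx, liftTor]
    exact (Int.natCast_div _ _).symm
  simp only [siteOfPt, h1, Int.cast_natCast]
  rfl

/-- **PERIODICITY**: translating a fine point by the period `N₀` in one direction does not change its level-`j` site (`j ≤ m + K`). [folklore] -/
theorem siteOfPt_add_single_period {j : ℕ} (hj : j ≤ P.m + P.K) (x : Pt P.d) (μ : Fin P.d) :
    siteOfPt P j (x + Pi.single μ ((P.sitesPerDir 0 : ℕ) : ℤ)) = siteOfPt P j x := by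
  have hLj : 0 < P.L ^ j := pow_pos P.L_pos j
  have e1 : ((P.sitesPerDir 0 : ℕ) : ℤ) = (P.sitesPerDir j : ℤ) * ((P.L ^ j : ℕ) : ℤ) := by
    rw [← pow_mul_sitesPerDir P hj]; push_cast; ring
  rw [e1]
  funext ν
  simp only [siteOfPt]
  rw [cubeIdx_add_single_mul (P.L ^ j) hLj x μ]
  by_cases hν : ν = μ
  · subst hν
    simp
  · simp [Pi.single_eq_of_ne hν]

/-! ## §2 The bad fine-point set of a level-`j` plaquette set -/

variable {P}

/-- The four corner sites `x, x + e_μ, x + e_ν, x + e_μ + e_ν` of a plaquette. [folklore] -/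
def plaqSites {j : ℕ} (p : Plaq P j) : Finset (Site P j) :=
  {p.src, p.src.shift p.μ, p.src.shift p.ν, (p.src.shift p.μ).shift p.ν}

/-- The base point is a corner. [folklore] -/
theorem src_mem_plaqSites {j : ℕ} (p : Plaq P j) : p.src ∈ plaqSites p := by
  simp [plaqSites]

variable (P)

/-- **THE BAD FINE-POINT SET** of a finite set `Z` of level-`j` torus plaquettes: the fine points of the cover whose level-`j` site is a corner
of a plaquette of `Z`. [folklore] -/
def badOfPlaqs (j : ℕ) (Z : Finset (Plaq P j)) : Set (Pt P.d) := {x | ∃ p ∈ Z, siteOfPt P j x ∈ plaqSites p}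

/-- Membership, unfolded. [folklore] -/
theorem mem_badOfPlaqs_iff {j : ℕ} {Z : Finset (Plaq P j)} {x : Pt P.d} :
    x ∈ badOfPlaqs P j Z ↔ ∃ p ∈ Z, siteOfPt P j x ∈ plaqSites p := Iff.rfl

/-- No bad plaquettes, no bad points. [folklore] -/
@[simp] theorem badOfPlaqs_empty (j : ℕ) : badOfPlaqs P j (∅ : Finset (Plaq P j)) = ∅ := by
  ext x; simp [badOfPlaqs]

/-- Monotone in the plaquette set. [folklore] -/
theorem badOfPlaqs_mono {j : ℕ} {Z Z' : Finset (Plaq P j)} (h : Z ⊆ Z') : badOfPlaqs P j Z ⊆ badOfPlaqs P j Z' :=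
  fun _ ⟨p, hp, hx⟩ => ⟨p, h hp, hx⟩

/-- Additive under union. [folklore] -/
theorem badOfPlaqs_union {j : ℕ} [DecidableEq (Plaq P j)] (Z Z' : Finset (Plaq P j)) :
    badOfPlaqs P j (Z ∪ Z') = badOfPlaqs P j Z ∪ badOfPlaqs P j Z' := by
  ext x
  simp only [badOfPlaqs, Set.mem_setOf_eq, Finset.mem_union, Set.mem_union]
  constructor
  · rintro ⟨p, hp | hp, hx⟩
    · exact Or.inl ⟨p, hp, hx⟩
    · exact Or.inr ⟨p, hp, hx⟩
  · rintro (⟨p, hp, hx⟩ | ⟨p, hp, hx⟩)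
    · exact ⟨p, Or.inl hp, hx⟩
    · exact ⟨p, Or.inr hp, hx⟩

/-- A fine point lying over a corner of a listed plaquette is bad (non-vacuity of the reading). [folklore] -/
theorem mem_badOfPlaqs_of_siteOfPt_eq_src {j : ℕ} {Z : Finset (Plaq P j)} {p : Plaq P j} (hp : p ∈ Z) {x : Pt P.d}
    (hx : siteOfPt P j x = p.src) : x ∈ badOfPlaqs P j Z :=
  ⟨p, hp, by rw [hx]; exact src_mem_plaqSites p⟩

/-- The bad set is a UNION OF `L^j`-BLOCKS (it sees `x` only through `⌊x/L^j⌋`). [folklore] -/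
theorem badOfPlaqs_isUnionOfCubes (j : ℕ) (Z : Finset (Plaq P j)) : IsUnionOfCubes (P.L ^ j) (badOfPlaqs P j Z) := by
  intro x y hxy
  simp only [badOfPlaqs, Set.mem_setOf_eq, siteOfPt_eq_of_cubeIdx_eq P hxy]

/-- **The bad set is `N₀`-PERIODIC** (`j ≤ m + K`). [folklore] -/
theorem badOfPlaqs_periodic {j : ℕ} (hj : j ≤ P.m + P.K) (Z : Finset (Plaq P j)) : SetPeriodic (finePeriod P) (badOfPlaqs P j Z) := by
  intro x μ
  simp only [badOfPlaqs, Set.mem_setOf_eq, finePeriod, siteOfPt_add_single_period P hj x μ]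

/-! ## §3 The reading map for a per-level family and the periodic domain tower -/

open Classical in
/-- **THE READING MAP** «per-level torus plaquette sets ↦ bad fine-point sets»: `badOfObserved P Z j = badOfPlaqs P j (Z j)` within the standing
range `j ≤ m + K`, and `∅` above it. [folklore] -/
def badOfObserved (Z : (j : ℕ) → Finset (Plaq P j)) (j : ℕ) : Set (Pt P.d) :=
  if j ≤ P.m + P.K then badOfPlaqs P j (Z j) else ∅

/-- Within the standing range the reading map is `badOfPlaqs`. [folklore] -/
theorem badOfObserved_of_le (Z : (j : ℕ) → Finset (Plaq P j)) {j : ℕ} (hj : j ≤ P.m + P.K) :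
    badOfObserved P Z j = badOfPlaqs P j (Z j) := by
  simp [badOfObserved, hj]

/-- Above the standing range nothing is bad. [folklore] -/
theorem badOfObserved_of_lt (Z : (j : ℕ) → Finset (Plaq P j)) {j : ℕ} (hj : P.m + P.K < j) : badOfObserved P Z j = ∅ := by
  simp [badOfObserved, Nat.not_le.mpr hj]

/-- Membership within the standing range. [folklore] -/
theorem mem_badOfObserved_iff (Z : (j : ℕ) → Finset (Plaq P j)) {j : ℕ} (hj : j ≤ P.m + P.K) {x : Pt P.d} :
    x ∈ badOfObserved P Z j ↔ ∃ p ∈ Z j, siteOfPt P j x ∈ plaqSites p := by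
  rw [badOfObserved_of_le P Z hj]; exact Iff.rfl

/-- **The bad sets are `N₀`-periodic at EVERY level.** [folklore] -/
theorem badOfObserved_periodic (Z : (j : ℕ) → Finset (Plaq P j)) (j : ℕ) : SetPeriodic (finePeriod P) (badOfObserved P Z j) := by
  by_cases hj : j ≤ P.m + P.K
  · rw [badOfObserved_of_le P Z hj]; exact badOfPlaqs_periodic P hj (Z j)
  · rw [badOfObserved_of_lt P Z (Nat.lt_of_not_le hj)]; exact SetPeriodic.empty _

/-- Every bad set is a union of `L^j`-blocks. [folklore] -/
theorem badOfObserved_isUnionOfCubes (Z : (j : ℕ) → Finset (Plaq P j)) (j : ℕ) : IsUnionOfCubes (P.L ^ j) (badOfObserved P Z j) := by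
  by_cases hj : j ≤ P.m + P.K
  · rw [badOfObserved_of_le P Z hj]; exact badOfPlaqs_isUnionOfCubes P j (Z j)
  · rw [badOfObserved_of_lt P Z (Nat.lt_of_not_le hj)]; exact isUnionOfCubes_empty _

/-- **THE PERIODIC DOMAIN TOWER OF AN OBSERVED HISTORY**: for a periodic `Ω₀` and big-block sides dividing the period (`M₁L^j ∣ N₀`, `j ≤ k`;
`M₁ ≥ 1`), the domain tower `domainTower L M₁ R Ω₀ (badOfObserved P Z)` is `N₀`-periodic at every level `j ≤ k` (`domainTower_periodic` BY NAME).
[folklore] -/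
theorem domainTower_badOfObserved_periodic (Z : (j : ℕ) → Finset (Plaq P j)) {M₁ R k : ℕ} (hM₁ : 0 < M₁) {Ω₀ : Set (Pt P.d)}
    (hΩ₀ : SetPeriodic (finePeriod P) Ω₀) (hdiv : ∀ j ≤ k, ∀ μ : Fin P.d, M₁ * P.L ^ j ∣ finePeriod P μ) :
    ∀ j ≤ k, SetPeriodic (finePeriod P) (domainTower P.L M₁ R Ω₀ (badOfObserved P Z) j) :=
  domainTower_periodic P.L M₁ R hM₁ P.L_pos hΩ₀ (badOfObserved_periodic P Z) hdiv

/-! ## §4 (v1.1) Stage lists ↦ per-level plaquette sets: the junction with `SubstrateLargeFieldNestedSharp.observed` -/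

section Stages
variable {P}

open Classical in
/-- (v1.1; XREAD leaf-05-g17 INFO-2, journal l.16307: «`observed` is a STAGE list at ONE level `j`, §3's input is a PER-LEVEL family — the stage ↦ level
indexing is typed in no module».)  THE UNION OF THE STAGE SETS of a one-level history: a plaquette is recorded at level `j` iff SOME stage of the level-`j`
observed history `SubstrateLargeFieldNestedSharp.observed specs hist V : List (Finset (Plaq P j))` records it.  DECLARED READING (the cell's): «bad at
level `j`» accumulates over the stages of that level. [folklore] -/
def stagesUnion {j : ℕ} : List (Finset (Plaq P j)) → Finset (Plaq P j)
  | [] => ∅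
  | Z :: rest => Z ∪ stagesUnion rest

/-- A plaquette is in the union iff some stage records it. [folklore] -/
theorem mem_stagesUnion_iff {j : ℕ} {p : Plaq P j} : ∀ {hist : List (Finset (Plaq P j))}, p ∈ stagesUnion hist ↔ ∃ Z ∈ hist, p ∈ Z
  | [] => by simp [stagesUnion]
  | Z :: rest => by
    classical
    rw [stagesUnion, Finset.mem_union, mem_stagesUnion_iff]
    simp

/-- No stages, nothing recorded. [folklore] -/
@[simp] theorem stagesUnion_nil {j : ℕ} : stagesUnion (P := P) (j := j) [] = ∅ := rfl

/-- Every stage set lies in the union. [folklore] -/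
theorem subset_stagesUnion {j : ℕ} {hist : List (Finset (Plaq P j))} {Z : Finset (Plaq P j)} (hZ : Z ∈ hist) : Z ⊆ stagesUnion hist :=
  fun _ hp => mem_stagesUnion_iff.mpr ⟨Z, hZ, hp⟩

variable (P)

/-- **THE READING MAP FROM PER-LEVEL STAGE HISTORIES**: `badOfHistories P H := badOfObserved P (fun j => stagesUnion (H j))` for a family of one-level stage
lists `H : (j : ℕ) → List (Finset (Plaq P j))` — e.g. `H j := SubstrateLargeFieldNestedSharp.observed (specs j) (hist j) (V j)` of the level-`j` field. [folklore] -/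
def badOfHistories (H : (j : ℕ) → List (Finset (Plaq P j))) : ℕ → Set (Pt P.d) := badOfObserved P fun j => stagesUnion (H j)

/-- Membership within the standing range: bad at level `j` iff the level-`j` site of the point is a corner of a plaquette recorded at SOME stage of the
level-`j` history. [folklore] -/
theorem mem_badOfHistories_iff (H : (j : ℕ) → List (Finset (Plaq P j))) {j : ℕ} (hj : j ≤ P.m + P.K) {x : Pt P.d} :
    x ∈ badOfHistories P H j ↔ ∃ Z ∈ H j, ∃ p ∈ Z, siteOfPt P j x ∈ plaqSites p := by
  rw [badOfHistories, mem_badOfObserved_iff P _ hj]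
  constructor
  · rintro ⟨p, hp, hx⟩
    obtain ⟨Z, hZ, hpZ⟩ := mem_stagesUnion_iff.mp hp
    exact ⟨Z, hZ, p, hpZ, hx⟩
  · rintro ⟨Z, hZ, p, hpZ, hx⟩
    exact ⟨p, subset_stagesUnion hZ hpZ, hx⟩

/-- The bad set of ONE stage lies in the bad set of its level's history. [folklore] -/
theorem badOfPlaqs_subset_badOfHistories (H : (j : ℕ) → List (Finset (Plaq P j))) {j : ℕ} (hj : j ≤ P.m + P.K) {Z : Finset (Plaq P j)}
    (hZ : Z ∈ H j) : badOfPlaqs P j Z ⊆ badOfHistories P H j := by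
  rw [badOfHistories, badOfObserved_of_le P _ hj]
  exact badOfPlaqs_mono P (subset_stagesUnion hZ)

/-- The history bad sets are periodic at every level, so the domain tower built on them is periodic (`domainTower_badOfObserved_periodic`). [folklore] -/
theorem domainTower_badOfHistories_periodic (H : (j : ℕ) → List (Finset (Plaq P j))) {M₁ R k : ℕ} (hM₁ : 0 < M₁) {Ω₀ : Set (Pt P.d)}
    (hΩ₀ : SetPeriodic (finePeriod P) Ω₀) (hdiv : ∀ j ≤ k, ∀ μ : Fin P.d, M₁ * P.L ^ j ∣ finePeriod P μ) :
    ∀ j ≤ k, SetPeriodic (finePeriod P) (domainTower P.L M₁ R Ω₀ (badOfHistories P H) j) :=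
  domainTower_badOfObserved_periodic P _ hM₁ hΩ₀ hdiv

end Stages

end Summit.QuantumFields.BalabanUV.T4Continuum.SmallFieldDomains

end
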